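import Mathlib
import HarnessLib
import Literature.Analysis.FluidPDE.VectorCalculus
import Literature.Analysis.FluidPDE.VectorCalculusProofs
import Literature.Analysis.FluidPDE.VorticityCalculus
import Literature.Analysis.FluidPDE.VorticityEquation
import Literature.Analysis.FluidPDE.AncientSimilarityVorticity
import Literature.Analysis.FluidPDE.AxisymmetricVorticityTransport
import Literature.Analysis.FluidPDE.EssCurry
import Literature.Analysis.FluidPDE.TypeIAncientMildClassical
import Literature.Analysis.PDE.HeatLiouville
import Summits.NavierStokesRegularity.NavierStokesRegularity.Theorems.LocalSineTubeDoorProfileAlignedWindowRigidityAncient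
import Summits.NavierStokesRegularity.NavierStokesRegularity.Theorems.PoloidalWindowDoorPoloidalWindowRigidityWindow
import Summits.NavierStokesRegularity.NavierStokesRegularity.Theorems.PoloidalWindowDoorPoloidalWindowRigidityDegenerate
import Summits.NavierStokesRegularity.NavierStokesRegularity.Theorems.PoloidalWindowDoorPoloidalWindowRigidityClassRate

/-!
# The one-window door family — GENERALISED-BELTRAMI Type-I profiles are trivial (profile side of the second-order
# Lamb-vector door: `curl (u × ω)` fading)

Cell ns-regularity-ideate, seat p6 (route-directed support for nsreg-p1's door family; anchor
`--supports stmt-NavierStokesRegularity-20018`, the profile-rigidity item of the family).  Sequel of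
`…LocalLambTubeDoorBeltramiProfileRigidity` (Beltrami profiles, `v × ω ≡ 0`): the only place where the Beltrami
condition entered there was the pointwise identity `(v·∇)ω = (ω·∇)v` (`convect_curl_eq_of_beltrami`), i.e.
`curl (v × ω) = 0` — the GENERALISED BELTRAMI condition (flows whose Lamb vector is locally a gradient; the vorticity
equation is then locally the HEAT EQUATION `∂ₜω = Δω`).  This file runs the same chain under that weaker, SECOND-ORDER
hypothesis:

**a profile of the family's Type-I class** (rate `‖v(t,x)‖ ≤ C/√(−t)`, continuity on the open slab, unit-viscosity
Oseen–Duhamel identity, divergence-free slices) **with `(v(s)·∇) curl v(s) = (curl v(s)·∇) v(s)` on every slice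
`s < 0` is identically zero** (`eq_zero_of_convect_comm`): its vorticity is a classical ancient caloric field
(`timeDeriv_curl_eq_laplacian_of_convect_comm`) bounded by `C₂/(−s₀)` below every `s₀ < 0` (class vorticity rate,
`…ClassRate.exists_curl_rate_of_class`), hence constant there (`Literature.Analysis.PDE.heat_liouville` via
`dt_uncurry`/`lap_uncurry`), and the constant is `O(1/(−t))`, hence zero (`curl_eq_zero_of_convect_comm`); irrotational
profiles of the class vanish (`…Degenerate`).  Window → slab: the commutator `y ↦ Dv(s)(y)[curl v(s)(y)] −
D(curl v(s))(y)[v(s)(y)]` of a slice is real-analytic (`analyticOnNhd_convectComm_slice`), so its vanishing on a nonempty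
open window of every slice spreads (`convectCommWindowToSlab`, `generalisedBeltramiWindowRigidity`).

WHAT THIS IS NOT: not a claim about Navier–Stokes regularity (Clay A) — the profile-rigidity half of a local regularity
CRITERION (conditional on local Type I) of the door family (bears_on LADDER-NS N0); establishment in the cell's sense
still requires the cross-family referee PASS + independent reproduction.
-/

noncomputable section

-- the summit and its single sub-problem share the name (CONVENTIONS §1), as in every Theorems file
set_option linter.dupNamespace false

namespace Summit.NavierStokesRegularity.NavierStokesRegularity.Theorems.LocalLambTubeDoorGeneralisedBeltramiProfileRigidity

open MeasureTheory Set Function Filter Topology TopologicalSpace Metric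
open scoped RealInnerProductSpace InnerProductSpace Laplacian ContDiff
open Literature.Analysis Literature.Analysis.FluidPDE
open Summit.NavierStokesRegularity.NavierStokesRegularity.Theorems.LocalSineTubeDoorProfileAlignedWindowRigidityAncient
open Summit.NavierStokesRegularity.NavierStokesRegularity.Theorems.PoloidalWindowDoorPoloidalWindowRigidityWindow
open Summit.NavierStokesRegularity.NavierStokesRegularity.Theorems.PoloidalWindowDoorPoloidalWindowRigidityDegenerate
open Summit.NavierStokesRegularity.NavierStokesRegularity.Theorems.PoloidalWindowDoorPoloidalWindowRigidityClassRate

variable {C : ℝ} {v : ℝ → EuclideanSpace ℝ (Fin 3) → EuclideanSpace ℝ (Fin 3)}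

/-! ### the vorticity of a generalised-Beltrami profile is caloric -/

/-- **The vorticity of a generalised-Beltrami profile of the class solves the heat equation** `∂ₜ curl v = Δ curl v`
pointwise on the open slab (two-sided time derivative): the profile is a classical Navier–Stokes solution on every window
`(t₀, 0)`, and in its vorticity equation `∂ₜω + (v·∇)ω = (ω·∇)v + Δω` the transport and stretching terms cancel by
hypothesis. -/
theorem timeDeriv_curl_eq_laplacian_of_convect_comm (hrate : HasTypeITimeDecay C v)
    (hcont : ContinuousOn (uncurry v) (Iio (0 : ℝ) ×ˢ univ))
    (hmild : ∀ s t : ℝ, s < t → t < 0 → ∀ x,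
      v t x = UnboundedOperators.heatExtension (v s) (t - s) x - oseenDuhamel 1 s v v t x)
    (hdiv : ∀ t < 0, VectorCalculus.IsDivFree (v t))
    (hcomm : ∀ s < 0, ∀ y, convect (v s) (curl (v s)) y = convect (curl (v s)) (v s) y) {t : ℝ} (ht : t < 0)
    (x : EuclideanSpace ℝ (Fin 3)) :
    FluidPDE.timeDeriv (vorticity v) t x = (Δ (curl (v t))) x := by
  have hA : IsTypeIAncientMild C v := isTypeIAncientMild_of_class hrate hcont hmild hdiv
  have ht₀ : t - 1 < 0 := by linarith
  have htI : t ∈ Ioo (t - 1) 0 := ⟨by linarith, ht⟩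
  obtain ⟨p, hcl⟩ := hA.exists_isClassicalNSSolutionOn_Ioo ht₀
  have hveq := hcl.vorticity_eq isOpen_Ioo.uniqueDiffOn (by rw [isOpen_Ioo.interior_eq]; exact subset_closure)
    (fun _ _ y => curl_zero y) htI x
  rw [vorticity_apply, hcomm t ht x, one_smul] at hveq
  have hwt : timeDerivWithin (Ioo (t - 1) 0) (vorticity v) t x = (Δ (curl (v t))) x :=
    add_right_cancel (hveq.trans (add_comm _ _))
  rw [← hwt, timeDerivWithin_apply, FluidPDE.timeDeriv_apply, derivWithin_of_isOpen isOpen_Ioo htI]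

/-- **Generalised-Beltrami profiles of the class are irrotational.**  The vorticity is a bounded ancient caloric field
on every slab `(−∞, s₀) × ℝ³`, `s₀ < 0` (bound `C₂/(−s₀)` from the class's vorticity rate), hence constant there
(`Literature.Analysis.PDE.heat_liouville`), and the constant is `O(1/(−t))` as `t → −∞`, hence zero. -/
theorem curl_eq_zero_of_convect_comm (hrate : HasTypeITimeDecay C v)
    (hcont : ContinuousOn (uncurry v) (Iio (0 : ℝ) ×ˢ univ))
    (hmild : ∀ s t : ℝ, s < t → t < 0 → ∀ x,
      v t x = UnboundedOperators.heatExtension (v s) (t - s) x - oseenDuhamel 1 s v v t x)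
    (hdiv : ∀ t < 0, VectorCalculus.IsDivFree (v t))
    (hcomm : ∀ s < 0, ∀ y, convect (v s) (curl (v s)) y = convect (curl (v s)) (v s) y) :
    ∀ t < 0, ∀ x, curl (v t) x = 0 := by
  have hA : IsTypeIAncientMild C v := isTypeIAncientMild_of_class hrate hcont hmild hdiv
  obtain ⟨C₂, hC₂⟩ := exists_curl_rate_of_class hrate hcont hmild
  have hC₂0 : 0 ≤ C₂ := by
    have h := hC₂ (-1) (by norm_num) 0
    rw [neg_neg, div_one] at h
    exact (norm_nonneg _).trans h
  -- joint smoothness of the vorticity on the open slab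
  have hsm : IsSmoothSpaceTimeOn (Iio 0) v := hA.contDiffOn
  have hsmω : IsSmoothSpaceTimeOn (Iio 0) (vorticity v) := hsm.isSmoothSpaceTimeOn_vorticity isOpen_Iio.uniqueDiffOn
  have hO : IsOpen (Iio (0 : ℝ) ×ˢ (univ : Set (EuclideanSpace ℝ (Fin 3)))) := isOpen_Iio.prod isOpen_univ
  have hω2 : ContDiffOn ℝ 2 (uncurry (vorticity v)) (Iio (0 : ℝ) ×ˢ univ) := hsmω.of_le (by norm_cast)
  -- the heat equation in the Carleman frame, on the whole open slab
  have hheat : ∀ z ∈ Iio (0 : ℝ) ×ˢ (univ : Set (EuclideanSpace ℝ (Fin 3))),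
      Carleman.dt (uncurry (vorticity v)) z = Carleman.lap (uncurry (vorticity v)) z := by
    rintro ⟨t, x⟩ hz
    have ht : t < 0 := (mem_prod.1 hz).1
    have hd : DifferentiableAt ℝ (uncurry (vorticity v)) (t, x) :=
      (hω2.differentiableOn (by norm_num)).differentiableAt (hO.mem_nhds hz)
    rw [Carleman.dt_uncurry hd, Carleman.lap_uncurry hO hz hω2,
      timeDeriv_curl_eq_laplacian_of_convect_comm hrate hcont hmild hdiv hcomm ht x, vorticity_apply]
  -- constancy below every `s₀ < 0`
  have hconst : ∀ s₀ < 0, ∀ t t' : ℝ, t < s₀ → t' < s₀ → ∀ x x' : EuclideanSpace ℝ (Fin 3),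
      curl (v t) x = curl (v t') x' := by
    intro s₀ hs₀ t t' ht ht' x x'
    have hsub : Iio s₀ ×ˢ (univ : Set (EuclideanSpace ℝ (Fin 3))) ⊆ Iio 0 ×ˢ univ :=
      prod_mono (Iio_subset_Iio hs₀.le) Subset.rfl
    have key := Literature.Analysis.PDE.heat_liouville (u := uncurry (vorticity v)) (T := s₀) (A := C₂ / (-s₀))
      (γ := 0) le_rfl zero_lt_one (hω2.mono hsub) (fun z hz => hheat z (hsub hz)) ?_
      (z := (t, x)) (w := (t', x')) (mem_prod.2 ⟨ht, mem_univ _⟩) (mem_prod.2 ⟨ht', mem_univ _⟩)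
    · simpa [vorticity_apply] using key
    · rintro ⟨τ, y⟩ hz
      have hτ : τ < s₀ := (mem_prod.1 hz).1
      have hτ0 : τ < 0 := hτ.trans hs₀
      rw [Real.rpow_zero, mul_one]
      show ‖vorticity v τ y‖ ≤ C₂ / (-s₀)
      rw [vorticity_apply]
      calc ‖curl (v τ) y‖ ≤ C₂ / (-τ) := hC₂ τ hτ0 y
        _ ≤ C₂ / (-s₀) := div_le_div_of_nonneg_left hC₂0 (by linarith) (by linarith)
  -- the constant is `O(1/(−t))`, hence zero
  intro t ht x
  by_contra hne
  set ε : ℝ := ‖curl (v t) x‖ with hε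
  have hε0 : 0 < ε := norm_pos_iff.2 hne
  set t' : ℝ := t - 1 - C₂ / ε with ht'def
  have hq : 0 ≤ C₂ / ε := div_nonneg hC₂0 hε0.le
  have ht's : t' < t / 2 := by rw [ht'def]; linarith
  have hts : t < t / 2 := by linarith
  have hs₀ : t / 2 < 0 := by linarith
  have ht'0 : 0 < -t' := by rw [ht'def]; linarith
  have heq : curl (v t) x = curl (v t') x := hconst (t / 2) hs₀ t t' hts ht's x x
  have hb : ε ≤ C₂ / (-t') := by rw [hε, heq]; exact hC₂ t' (by linarith) x
  have hlt : C₂ / (-t') < ε := by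
    rw [div_lt_iff₀ ht'0, ht'def]
    have : ε * (-(t - 1 - C₂ / ε)) = ε * (1 - t) + C₂ := by field_simp; ring
    rw [this]
    nlinarith
  linarith

/-- **GENERALISED-BELTRAMI TYPE-I PROFILES ARE TRIVIAL**: a profile of the class with `(v·∇)ω = (ω·∇)v` on every slice
is identically zero. -/
theorem eq_zero_of_convect_comm (hrate : HasTypeITimeDecay C v)
    (hcont : ContinuousOn (uncurry v) (Iio (0 : ℝ) ×ˢ univ))
    (hmild : ∀ s t : ℝ, s < t → t < 0 → ∀ x,
      v t x = UnboundedOperators.heatExtension (v s) (t - s) x - oseenDuhamel 1 s v v t x)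
    (hdiv : ∀ t < 0, VectorCalculus.IsDivFree (v t))
    (hcomm : ∀ s < 0, ∀ y, convect (v s) (curl (v s)) y = convect (curl (v s)) (v s) y) :
    ∀ t < 0, ∀ x, v t x = 0 :=
  eq_zero_of_irrotational hrate hcont hmild hdiv (curl_eq_zero_of_convect_comm hrate hcont hmild hdiv hcomm)

/-- **The generalised-Beltrami stratum of the family's profile class is settled**: such a profile is not
backward-singular. -/
theorem not_backwardSingular_of_convect_comm (hrate : HasTypeITimeDecay C v)
    (hcont : ContinuousOn (uncurry v) (Iio (0 : ℝ) ×ˢ univ))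
    (hmild : ∀ s t : ℝ, s < t → t < 0 → ∀ x,
      v t x = UnboundedOperators.heatExtension (v s) (t - s) x - oseenDuhamel 1 s v v t x)
    (hdiv : ∀ t < 0, VectorCalculus.IsDivFree (v t))
    (hcomm : ∀ s < 0, ∀ y, convect (v s) (curl (v s)) y = convect (curl (v s)) (v s) y) :
    ¬ IsBackwardSingularPoint v 0 :=
  nonflatLiouville_of_irrotational hrate hcont hmild hdiv (curl_eq_zero_of_convect_comm hrate hcont hmild hdiv hcomm)

/-! ### window → slab for the commutator `(ω·∇)v − (v·∇)ω` -/

/-- **The commutator `y ↦ Dv(s)(y)[curl v(s)(y)] − D(curl v(s))(y)[v(s)(y)]` of a slice of a profile of the class is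
real-analytic** (slice analyticity, tree `…Ancient.analyticOnNhd_slice`; derivatives and evaluations of analytic maps). -/
theorem analyticOnNhd_convectComm_slice (hrate : HasTypeITimeDecay C v)
    (hcont : ContinuousOn (uncurry v) (Iio (0 : ℝ) ×ˢ univ))
    (hmild : ∀ s t : ℝ, s < t → t < 0 → ∀ x,
      v t x = UnboundedOperators.heatExtension (v s) (t - s) x - oseenDuhamel 1 s v v t x)
    {s : ℝ} (hs : s < 0) :
    AnalyticOnNhd ℝ (fun y => convect (curl (v s)) (v s) y - convect (v s) (curl (v s)) y) univ := by
  have hslice := analyticOnNhd_slice hcont (bdd_of_hasTypeITimeDecay hrate) hmild hs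
  have hcurl := analyticOnNhd_curl hslice
  intro y hy
  set ev : (EuclideanSpace ℝ (Fin 3) →L[ℝ] EuclideanSpace ℝ (Fin 3)) →L[ℝ]
      EuclideanSpace ℝ (Fin 3) →L[ℝ] EuclideanSpace ℝ (Fin 3) :=
    ContinuousLinearMap.id ℝ (EuclideanSpace ℝ (Fin 3) →L[ℝ] EuclideanSpace ℝ (Fin 3)) with hev
  have h1 : AnalyticAt ℝ (fun y => fderiv ℝ (v s) y (curl (v s) y)) y :=
    (ev.analyticAt_bilinear (fderiv ℝ (v s) y, curl (v s) y)).comp₂ (hslice.fderiv y hy) (hcurl y hy)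
  have h2 : AnalyticAt ℝ (fun y => fderiv ℝ (curl (v s)) y (v s y)) y :=
    (ev.analyticAt_bilinear (fderiv ℝ (curl (v s)) y, v s y)).comp₂ (hcurl.fderiv y hy) (hslice y hy)
  exact h1.sub h2

/-- **Window → slab for the commutator**: for a profile of the class, if at every `s < 0` the identity
`(v·∇)ω = (ω·∇)v` holds on some nonempty open window, it holds on every slice (identity theorem on the connected `ℝ³`). -/
theorem convectCommWindowToSlab (hrate : HasTypeITimeDecay C v)
    (hcont : ContinuousOn (uncurry v) (Iio (0 : ℝ) ×ˢ univ))
    (hmild : ∀ s t : ℝ, s < t → t < 0 → ∀ x,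
      v t x = UnboundedOperators.heatExtension (v s) (t - s) x - oseenDuhamel 1 s v v t x)
    (hwin : ∀ s < 0, ∃ U : Set (EuclideanSpace ℝ (Fin 3)), IsOpen U ∧ U.Nonempty ∧
      ∀ y ∈ U, convect (v s) (curl (v s)) y = convect (curl (v s)) (v s) y) :
    ∀ s < 0, ∀ y, convect (v s) (curl (v s)) y = convect (curl (v s)) (v s) y := by
  intro s hs y
  obtain ⟨U, hU, ⟨y₀, hy₀⟩, hal⟩ := hwin s hs
  have hev : (fun y => convect (curl (v s)) (v s) y - convect (v s) (curl (v s)) y) =ᶠ[𝓝 y₀] 0 :=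
    Filter.eventually_of_mem (hU.mem_nhds hy₀) fun y hy => by
      simp only [Pi.zero_apply, hal y hy, sub_self]
  have h := (analyticOnNhd_convectComm_slice hrate hcont hmild hs).eqOn_zero_of_preconnected_of_eventuallyEq_zero
    isPreconnected_univ (mem_univ y₀) hev (mem_univ y)
  exact (sub_eq_zero.1 h).symm

/-- **THE PROFILE WINDOW CRUX OF THE GENERALISED-BELTRAMI DOOR, PROVED**: a profile of the family's Type-I class for
which, at every `s < 0`, the stretching and transport terms `Dv(s)(y)[curl v(s)(y)]` and `D(curl v(s))(y)[v(s)(y)]`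
agree on a nonempty open window (`curl (v × ω) = 0` there) is not backward-singular at the apex. -/
theorem generalisedBeltramiWindowRigidity :
    ∀ (C : ℝ) (v : ℝ → EuclideanSpace ℝ (Fin 3) → EuclideanSpace ℝ (Fin 3)),
      Literature.Analysis.FluidPDE.HasTypeITimeDecay C v →
      ContinuousOn (Function.uncurry v) (Set.Iio (0 : ℝ) ×ˢ Set.univ) →
      (∀ s t : ℝ, s < t → t < 0 → ∀ x, v t x =
        Literature.Analysis.UnboundedOperators.heatExtension (v s) (t - s) x -
          Literature.Analysis.FluidPDE.oseenDuhamel 1 s v v t x) →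
      (∀ t < 0, Literature.Analysis.FluidPDE.VectorCalculus.IsDivFree (v t)) →
      (∀ s < 0, ∃ U : Set (EuclideanSpace ℝ (Fin 3)), IsOpen U ∧ U.Nonempty ∧
        ∀ y ∈ U, fderiv ℝ (v s) y (Literature.Analysis.FluidPDE.curl (v s) y) =
          fderiv ℝ (Literature.Analysis.FluidPDE.curl (v s)) y (v s y)) →
      ¬ Literature.Analysis.FluidPDE.IsBackwardSingularPoint v 0 := by
  intro C v hrate hcont hmild hdiv hwin
  refine not_backwardSingular_of_convect_comm hrate hcont hmild hdiv
    (convectCommWindowToSlab hrate hcont hmild fun s hs => ?_)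
  obtain ⟨U, hU, hne, hal⟩ := hwin s hs
  exact ⟨U, hU, hne, fun y hy => by rw [convect_apply, convect_apply]; exact (hal y hy).symm⟩

end Summit.NavierStokesRegularity.NavierStokesRegularity.Theorems.LocalLambTubeDoorGeneralisedBeltramiProfileRigidity

end
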